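import Summits.BirchSwinnertonDyer.BirchSwinnertonDyer.Theorems.ClassRecordThreeEulerHalvesAtThreeCartanCorrespondenceCutTight
import Summits.BirchSwinnertonDyer.BirchSwinnertonDyer.Theorems.ClassRecordThreeEulerHalvesAtThreeCartanTorusCubeCutStubF2a
import HarnessLib

/-!
# Crux 23422 `EulerHalvesAtThreeResidualUpperBound`, line `cartan` v10 — the RESIDUE of the one registered stub (F2b♭)
# `stub_cartanHomLatticeDictionaryAtThreeVal : CartanDegree.CartanHomLatticeDictionaryAtThreeVal` BY NAME, now that S-K1′ is a tree theorem:
# (F2b♭) ⟹ NUM unconditionally; (F2b♭) ⟺ NUM given the finite-group lattice supply; the correspondence road without S-K1′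

Seat `bsd-stepL-tam3-p1` g22 (LINE OWNER of crux `stmt-BirchSwinnertonDyer-23422`; `--supports stmt-BirchSwinnertonDyer-23422 --as helper`).
Theorems only, sorry-free.

WHAT IS PROVED HERE.
* §1 `cubicTorusPeriodRatioAtThree : CartanDegree.CubicTorusPeriodRatioAtThree` — S-K1′ at EVERY prime `q ≠ 3`, UNCONDITIONAL (the registered stub (F2a)
  `CartanTorusCubeCut.stub_cubicTorusPeriodRatioAtThreeGeFive`, tam3-p1 g21 p688715, fed to `CartanDegree.cubicTorusPeriodRatioAtThree_of_geFive`, whose `q = 2`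
  case is `CartanDegree.cubicTorusPeriodRatio_two`, p678128); `latticeDegreeLawAtThree : CartanDegree.LatticeDegreeLawAtThree` likewise.
* §2 the residue of (F2b♭) BY NAME with S-K1′ discharged: `onePlaceLaw_of_dictionaryVal : (F2b♭) → NUM` (bsd-idea-10 g12's `CartanCorrespondence.onePlaceLaw_of_dictionaryVal`
  with its `h2a` binder removed), `dictionaryVal_of_supply_of_onePlaceLaw : supply → NUM → (F2b♭)`, `dictionaryVal_iff_onePlaceLaw : supply → ((F2b♭) ↔ NUM)`,
  and the correspondence road with S-K1′ removed: `dictionaryVal_of_correspondence : supply → S3♭ → COR → U♯ → SIGN → (F2b♭)`. So the open surface of the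
  registered stub is EXACTLY {NUM = `CartanCorrespondence.CartanOnePlaceDegreeLawAtThree` (geometric, NOT in print, Kohen–Pacetti Rem. 3.8)} ∪
  {`CartanCorrespondence.CartanTorusLatticeSupply` (finite-group theory: one integral model of `W_q` per prime `q ≠ 3`)}.
(The place `q = 2` of the two finite-group inputs — the sign lattice, the supply at `2`, the torus pair sum at `2` — is the sibling file
`…CartanSignLatticeTwo`.)
HONEST FRAMING: (F2b♭), NUM, the supply at `q ≥ 5`, COR, SIGN, S3♭ are NOT proved here; no summit statement, no route item and no registered stub is
proved; nothing is asserted about any curve; BSD is proved for no curve. Searched before filing: `lean search 'CubicTorusPeriodRatioAtThree'` (only the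
conditional `_of_geFive`), `lean search 'CartanTorusLatticeSupply'` (definition + consumers, no instance).
References: [cite: KohenPacetti2016, Rem. 3.8 and §2 (arXiv:1403.7801v3 pp. 7–8, 15)] [cite: Bump1997, §4.1] [cite: CaiShuTian2014, Prop. 3.8 p. 21].
-/

set_option linter.dupNamespace false -- the layout namespace `Summit.BirchSwinnertonDyer.BirchSwinnertonDyer.…` repeats the summit name (D-0017; as the sibling files)
set_option autoImplicit false

noncomputable section


namespace Summit.BirchSwinnertonDyer.BirchSwinnertonDyer.Theorems.CartanF2bResidue

open Summit.BirchSwinnertonDyer.BirchSwinnertonDyer.Theorems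
  Summit.BirchSwinnertonDyer.BirchSwinnertonDyer.Theorems.CartanDegree
  Summit.BirchSwinnertonDyer.BirchSwinnertonDyer.Theorems.CartanTorusCubeCut
  Summit.BirchSwinnertonDyer.BirchSwinnertonDyer.Theorems.CartanCorrespondence

/-! ## §1 S-K1′ and the lattice degree law at every prime `q ≠ 3`, unconditionally -/

/-- **S-K1′ at every prime `q ≠ 3`** (UNCONDITIONAL): `ord₃ B(w_s,w_s) + ord₃(q+1) = ord₃ B(w_C,w_C) + 1 + ord₃(q−1)` on every Cartan torus lattice —
the registered stub (F2a) for `q ≥ 5` (p688715) and the `q = 2` theorem, assembled by `cubicTorusPeriodRatioAtThree_of_geFive`. [folklore] -/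
theorem cubicTorusPeriodRatioAtThree : CubicTorusPeriodRatioAtThree :=
  cubicTorusPeriodRatioAtThree_of_geFive CartanTorusCubeCut.stub_cubicTorusPeriodRatioAtThreeGeFive

/-- **The lattice degree law at every prime `q ≠ 3`** (UNCONDITIONAL): every torus–degree datum has `ord₃ degX0 = ord₃ degC + 1`. [folklore] -/
theorem latticeDegreeLawAtThree : LatticeDegreeLawAtThree :=
  latticeDegreeLaw_of_periodRatio cubicTorusPeriodRatioAtThree

/-! ## §2 The residue of the registered stub (F2b♭) by name -/

/-- PROVED — **(F2b♭) ⟹ NUM, unconditionally**: the registered stub implies the bare one-place degree law (its datum obeys the lattice law). [folklore] -/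
theorem onePlaceLaw_of_dictionaryVal (h : CartanHomLatticeDictionaryAtThreeVal) : CartanOnePlaceDegreeLawAtThree :=
  CartanCorrespondence.onePlaceLaw_of_dictionaryVal cubicTorusPeriodRatioAtThree h

/-- PROVED — **supply ∧ NUM ⟹ (F2b♭)** (S-K1′ discharged in bsd-idea-10 g12's `dictionaryVal_of_onePlaceLaw`). [folklore] -/
theorem dictionaryVal_of_supply_of_onePlaceLaw (hL : CartanTorusLatticeSupply) (hN : CartanOnePlaceDegreeLawAtThree) :
    CartanHomLatticeDictionaryAtThreeVal :=
  dictionaryVal_of_onePlaceLaw cubicTorusPeriodRatioAtThree hL hN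

/-- PROVED — **given the finite-group supply, (F2b♭) ⟺ NUM**: the registered stub's geometric content is exactly the one-place degree law. [folklore] -/
theorem dictionaryVal_iff_onePlaceLaw (hL : CartanTorusLatticeSupply) :
    CartanHomLatticeDictionaryAtThreeVal ↔ CartanOnePlaceDegreeLawAtThree :=
  ⟨onePlaceLaw_of_dictionaryVal, dictionaryVal_of_supply_of_onePlaceLaw hL⟩

/-- PROVED — **the correspondence road without S-K1′**: supply → S3♭ → COR → U♯ → SIGN → (F2b♭). [folklore] -/
theorem dictionaryVal_of_correspondence (hL : CartanTorusLatticeSupply) (hS3 : CartanMinimalDegreeValAtThree)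
    (hC : CartanCorrespondenceDegreeIdentityAtThree) (hU : CubicTorusPairSumAtThree) (hsgn : CartanCorrespondenceSignAtThree) :
    CartanHomLatticeDictionaryAtThreeVal :=
  cartanHomLatticeDictionaryAtThreeVal_of_correspondence cubicTorusPeriodRatioAtThree hL hS3 hC hU hsgn

/-- PROVED — the `V`-minimal variant without S-K1′: supply → S3♭ → NUM_V → (F2b♭). [folklore] -/
theorem dictionaryVal_of_onePlaceLawVMin (hL : CartanTorusLatticeSupply) (hS3 : CartanMinimalDegreeValAtThree)
    (hN : CartanOnePlaceDegreeLawVMinAtThree) : CartanHomLatticeDictionaryAtThreeVal :=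
  cartanHomLatticeDictionaryAtThreeVal_of_onePlaceLawVMin cubicTorusPeriodRatioAtThree hL hS3 hN

end Summit.BirchSwinnertonDyer.BirchSwinnertonDyer.Theorems.CartanF2bResidue

end
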